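import Mathlib
import HarnessLib
import Summits.PneNP.PneNP.Theses.RamseyUncertifiable
import Literature.Combinatorics.SimpleGraph.LovaszTheta
import Literature.Combinatorics.SimpleGraph.LovaszThetaComplement
import Literature.Combinatorics.SimpleGraph.LasserreStableBound
import Literature.Combinatorics.SimpleGraph.LasserreLevelOne

/-!
# Sketch — crux ideas for `SosUncertainty` (stmt-PneNP-9815), ideator 1, round 1

First lemmas of the two idea cards, stated over existing declarations
(`lovaszTheta`, `lasserreStableBound`, Mathlib `SimpleGraph.IsClique/IsIndepSet/CliqueFree`).
Nothing here is proved; the point is that the statements elaborate.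
-/

set_option linter.dupNamespace false

namespace Summit.PneNP.PneNP.Cruxes.SosUncertainty.Sketch

open Literature.Combinatorics.SimpleGraph

/-! ## Card `tset-conflict-theta-defect` — three-coloured Lovász on t-set conflict graphs -/

/-- `t`-subsets of `Fin n`. -/
abbrev TSets (n t : ℕ) : Type := {S : Finset (Fin n) // S.card = t}

/-- Stable-conflict graph Φ_t(G): two distinct t-sets are adjacent iff their union is NOT a
stable (independent) set of `G`.  Its independent families are exactly the t-subsets of one
stable set, so α(Φ_t(G)) = C(α(G), t). -/
def stableConflict {n : ℕ} (G : SimpleGraph (Fin n)) (t : ℕ) : SimpleGraph (TSets n t) :=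
  SimpleGraph.fromRel fun S S' => ¬ G.IsIndepSet (↑(S.1 ∪ S'.1) : Set (Fin n))

/-- Clique-conflict graph Ψ_t(G) = Φ_t(Gᶜ): adjacent iff the union is NOT a clique of `G`. -/
def cliqueConflict {n : ℕ} (G : SimpleGraph (Fin n)) (t : ℕ) : SimpleGraph (TSets n t) :=
  SimpleGraph.fromRel fun S S' => ¬ G.IsClique (↑(S.1 ∪ S'.1) : Set (Fin n))

/-- Homogeneous-union graph Hom_t(G): adjacent iff the union IS homogeneous (a clique or a
stable set of `G`).  For t = 1 this is the complete graph. -/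
def homUnion {n : ℕ} (G : SimpleGraph (Fin n)) (t : ℕ) : SimpleGraph (TSets n t) :=
  SimpleGraph.fromRel fun S S' =>
    G.IsClique (↑(S.1 ∪ S'.1) : Set (Fin n)) ∨ G.IsIndepSet (↑(S.1 ∪ S'.1) : Set (Fin n))

/-- FIRST LEMMA of card 1 (★): the three-coloured Lovász inequality on t-sets.  For every
graph G on `Fin n` and 1 ≤ t ≤ n:  ϑ(Φ_t(G)) · ϑ(Φ_t(Gᶜ)) · ϑ(Hom_t(G)) ≥ C(n,t).
(t = 1 is Lovász 1979 Cor. 2 verbatim, since Hom_1 = K_n has ϑ = 1.)  Proof sketch: the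
pairs of distinct t-sets split into stable-union SU, clique-union CU, mixed M;
Φ = CU ∪ M, Ψ := Φ(Gᶜ) = SU ∪ M = complement of CU, Hom = SU ∪ CU; Lovász Cor. 2 gives
ϑ(CU)ϑ(Ψ) ≥ N and Knuth §20 + §15 (strong product, induced subgraphs) give
ϑ(CU) = ϑ(Φ ∩ Hom) ≤ ϑ(Φ)ϑ(Hom). -/
def ThreeColourLovasz : Prop :=
  ∀ n t : ℕ, 1 ≤ t → t ≤ n → ∀ G : SimpleGraph (Fin n),
    (Nat.choose n t : ℝ) ≤
      lovaszTheta (stableConflict G t) * lovaszTheta (stableConflict Gᶜ t) *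
        lovaszTheta (homUnion G t)

/-- The level-2 defect bound (B₂): ϑ(Hom_2(G)) is at most the sum over vertices of
ϑ(G[N(v)]) + ϑ(Gᶜ[V ∖ N[v]]) (truncated stars of Hom_2 are disjoint unions of these induced
graphs; ϑ is subadditive over vertex partitions, Alon–Kahale Fact 5.3). -/
def HomTwoDefect : Prop :=
  ∀ n : ℕ, ∀ (G : SimpleGraph (Fin n)) [DecidableRel G.Adj],
    lovaszTheta (homUnion G 2) ≤
      ∑ v : Fin n,
        (lovaszTheta (G.induce (↑(G.neighborFinset v) : Set (Fin n))) +
         lovaszTheta (Gᶜ.induce (↑((G.neighborFinset v ∪ {v})ᶜ) : Set (Fin n))))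

/-! Convention for "hom(G) ≤ n^η": we quantify over SMALL k (k ≤ n^η + 1) and ask
`G.CliqueFree k ∧ Gᶜ.CliqueFree k`; instantiating k = ⌈n^η⌉ recovers the intended hypothesis,
and quantifying over large k would make the hypothesis vacuous (every graph is
`CliqueFree (n+1)`). -/

/-- (A_t), the Hankelisation comparison = hardest stub of card 1: on graphs without
n^η-size homogeneous sets, theta of the stable-conflict graph on t-sets is polynomially
dominated by the level-t Lasserre value. -/
def ConflictThetaLeLasserre (t : ℕ) : Prop :=
  ∃ a η : ℝ, 0 ≤ a ∧ 0 < η ∧ ∃ n₀ : ℕ, ∀ n ≥ n₀, ∀ k : ℕ, (k : ℝ) ≤ (n : ℝ) ^ η + 1 →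
    ∀ G : SimpleGraph (Fin n), G.CliqueFree k → Gᶜ.CliqueFree k →
      lovaszTheta (stableConflict G t) ≤ (n : ℝ) ^ a * lasserreStableBound G t ^ t

/-! ## Card `theta-rich-side-degree-reduction` — one-sided bound at the √n threshold -/

/-- GS″_t: on a graph with no homogeneous set of size n^η, if level-t Lasserre certifies
α ≤ n^δ then level 1 (theta) already certifies α < √n.  Contrapositive reading: the side of
(G, Gᶜ) with ϑ ≥ √n (one always exists, ϑ(G)ϑ(Gᶜ) ≥ n) is level-t SoS-hard. -/
def ThetaRichSideHard (t : ℕ) : Prop :=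
  ∃ η δ : ℝ, 0 < η ∧ 0 < δ ∧ ∃ n₀ : ℕ, ∀ n ≥ n₀, ∀ k : ℕ, (k : ℝ) ≤ (n : ℝ) ^ η + 1 →
    ∀ G : SimpleGraph (Fin n), G.CliqueFree k → Gᶜ.CliqueFree k →
      lasserreStableBound G t ≤ (n : ℝ) ^ δ → lovaszTheta G < Real.sqrt n

/-- FIRST LEMMA of card 2 (pure logic + Lovász Cor. 2 + α ≤ las_t): GS″_t for one level t
implies UP at that level (the t-th instance of the crux `SosUncertainty`). -/
def DegreeReductionImpliesUP : Prop :=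
  ∀ t : ℕ, 1 ≤ t → ThetaRichSideHard t →
    ∃ δ : ℝ, 0 < δ ∧ ∃ n₀ : ℕ, ∀ n ≥ n₀, ∀ G : SimpleGraph (Fin n),
      (n : ℝ) ^ δ ≤ lasserreStableBound G t * lasserreStableBound Gᶜ t

/-- The a = O(1) endpoint of degree reduction, a theorem in print: Alon–Kahale 1998 Thm 5.1
(α(G) < k ⇒ ϑ(G) ≤ M n^{1-2/k}) composed with soundness α ≤ las_t: if level t certifies
α ≤ t (las_t(G) < t+1) then ϑ(G) ≤ M · n^{1 - 2/(t+1)}. -/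
def AlonKahaleEndpoint : Prop :=
  ∃ M : ℝ, 0 < M ∧ ∀ n t : ℕ, 1 ≤ t → ∀ G : SimpleGraph (Fin n),
    lasserreStableBound G t < t + 1 →
      lovaszTheta G ≤ M * (n : ℝ) ^ (1 - 2 / ((t : ℝ) + 1))

/-- Sanity: the crux as filed is literally `∀ t ≥ 1, (conclusion of DegreeReductionImpliesUP)`. -/
example (h : DegreeReductionImpliesUP) (hGS : ∀ t, 1 ≤ t → ThetaRichSideHard t) :
    Summit.PneNP.PneNP.Theses.RamseyUncertifiable.SosUncertainty :=
  fun t ht => h t ht (hGS t ht)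

end Summit.PneNP.PneNP.Cruxes.SosUncertainty.Sketch
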